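import Summits.AnomalousDissipation.AnomalousDissipation.Theses.NeutralTaylorWaves
import Literature.Analysis.FluidPDE.SteadyNSLatticePersistenceDrift
import Literature.Analysis.FluidPDE.SteadyNSLatticeLinearised
import Literature.Analysis.FunctionSpaces.TorusVectorParseval

/-!
# Stub `stub_aprioriTransfer` of line `Sketch` (crux `NewtonRealisation`, stmt-AnomalousDissipation-16315)

The crux's bordered `L²` a-priori bound at the state `(u₀, c)`, transferred to the Fourier-lattice state
space `W × ℝ` of `Literature.Analysis.FluidPDE.SteadyLattice` by Parseval: for `h ∈ W` with rapidly
decaying physical coefficients `ȟ` and `η ∈ ℝ`,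
`‖ȟ‖²_{ℓ²} + η² ≤ M² (‖(4π²ν)h − cD₃h + B(x₀,h) + B(h,x₀) − ηD₃x₀‖²_W + (ℓ h)²)`.

* §1 a real smooth pressure from a conjugate-symmetric symbol (scalar analogue of
  `SteadyLattice.conjVec_fourierSynth` / `realSynth_spec`), and the Hodge potential of a rapidly
  decaying conjugate-symmetric coefficient family: `𝓕(∇r)(k) = Π_k F(k) − F(k)`;
* §2 the synthesised test field `v = Re F_ȟ` is divergence free and mean zero;
* §3 the dictionary for the bordered linearised field and the registered stub.
-/

set_option linter.dupNamespace false

noncomputable section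

open scoped BigOperators Topology ENNReal NNReal InnerProductSpace ComplexConjugate
open Filter Set Function MeasureTheory UnitAddTorus
open Literature.Analysis Literature.Analysis.FunctionSpaces Literature.Analysis.FunctionSpaces.Torus
open Literature.Analysis.FunctionSpaces.EuclideanSpace
open Literature.Analysis.FluidPDE.ScalarFourier
open Literature.Analysis.FluidPDE.SteadyLattice Literature.Analysis.FluidPDE.SteadyLatticeDrift

namespace Summit.AnomalousDissipation.AnomalousDissipation.Theorems.NewtonRealisation.AprioriTransfer

/-- The flat unit three-torus (local notation). -/
local notation "𝕋³" => UnitAddTorus (Fin 3)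
/-- Velocity values (local notation). -/
local notation "E³" => EuclideanSpace ℝ (Fin 3)

/-- Square-summable families `ℤ³ → ℂ³` (local notation). -/
local notation "ℓ2" => lp (fun _ : Fin 3 → ℤ => EuclideanSpace ℂ (Fin 3)) 2
/-- The physical coefficients `x̌(k) = x(k)/|k|²` of a lattice family (local notation, = the frame's `cf`). -/
local notation:max "cf[" x "]" =>
  ((fun mm : Fin 3 → ℤ => (((freqNormSq mm)⁻¹ : ℝ) : ℂ)) • (x : (Fin 3 → ℤ) → EuclideanSpace ℂ (Fin 3)))
/-- The coordinates of an element of `ℓ²` / of the state space (local notation). -/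
local notation:max "cw[" x "]" => (((x : ℓ2)) : (Fin 3 → ℤ) → EuclideanSpace ℂ (Fin 3))
/-- The convective symbol `N(a, b)(k)` as a vector of `ℂ³` (local notation, = the frame's `nl`). -/
local notation:max "nl[" a "," b "]" k:max =>
  (WithLp.toLp 2 (fun pp : Fin 3 => transportSym (fun jj mm => (a : (Fin 3 → ℤ) → EuclideanSpace ℂ (Fin 3)) mm jj)
    (fun mm => (b : (Fin 3 → ℤ) → EuclideanSpace ℂ (Fin 3)) mm pp) k) : EuclideanSpace ℂ (Fin 3))
/-- `k · v` for `k ∈ ℤ³`, `v ∈ ℂ³` (local notation, = the frame's `kdot`). -/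
local notation:max "kdot[" k "," v "]" => (∑ jj : Fin 3, ((k jj : ℤ) : ℂ) * (v : EuclideanSpace ℂ (Fin 3)) jj)

/-! ## §1 A real pressure from a conjugate-symmetric symbol -/

/-- The Fourier synthesis of a rapidly decaying scalar family with `ph(−k) = conj (ph k)` is real:
`conj (F_ph y) = F_ph y` (scalar analogue of `SteadyLattice.conjVec_fourierSynth`). [folklore] -/
theorem conj_fourierSynth_scalar {ph : (Fin 3 → ℤ) → ℂ}
    (hcs : ∀ k, ph (-k) = conj (ph k)) (y : 𝕋³) : conj (fourierSynth ph y) = fourierSynth ph y := by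
  rw [fourierSynth, Complex.conj_tsum]
  have h : ∀ m, conj (mFourier m y • ph m) = mFourier (-m) y • ph (-m) := fun m => by
    rw [smul_eq_mul, smul_eq_mul, map_mul, hcs m, mFourier_neg]
  simp_rw [h]
  exact (Equiv.neg (Fin 3 → ℤ)).tsum_eq (fun m => mFourier m y • ph m)

/-- **Hodge potential on the lattice.** For a rapidly decaying conjugate-symmetric family `F` with
`F 0 = 0` there is a smooth REAL scalar `r` on `T³` with `𝓕(∇r)(k) = Π_k F(k) − F(k)` for every `k`
(pressure symbol `−(k·F(k))/(2πi|k|²)`, realness from conjugate symmetry). [folklore] -/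
theorem exists_hodgePotential {F : (Fin 3 → ℤ) → EuclideanSpace ℂ (Fin 3)} (hF : RapidDecay F)
    (hFs : IsConjSymm F) (hF0 : F 0 = 0) :
    ∃ r : 𝕋³ → ℝ, IsSmooth r ∧
      ∀ k : Fin 3 → ℤ, mFourierCoeff (complexify ∘ Torus.gradient r) k = FluidPDE.Torus.lerayCoeff k (F k) - F k := by
  -- the symbol
  have hnF : RapidDecay (fun k => -F k) := hF.of_norm_le_mul (C := 1) fun k => by rw [norm_neg, one_mul]
  set ph : (Fin 3 → ℤ) → ℂ := fun k => kdot[k, (-F k)] / (2 * Real.pi * Complex.I * ((freqNormSq k : ℝ) : ℂ))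
    with hph
  have hphr : RapidDecay ph := rapidDecay_pressureSymbol hnF
  have hI : (2 * Real.pi * Complex.I : ℂ) ≠ 0 :=
    mul_ne_zero (mul_ne_zero two_ne_zero (by exact_mod_cast Real.pi_ne_zero)) Complex.I_ne_zero
  have hphs : ∀ k, ph (-k) = conj (ph k) := by
    intro k
    simp only [hph]
    rw [freqNormSq_neg, kdot_neg, hFs k, ← conjVec_neg, ← conj_kdot]
    simp only [map_div₀, map_mul, Complex.conj_ofReal, Complex.conj_I, map_ofNat]
    field_simp
  -- the complex pressure and its realness
  set P : 𝕋³ → ℂ := fourierSynth ph with hP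
  have hPs : IsSmooth P := hphr.isSmooth_fourierSynth
  have hPc : ∀ k, mFourierCoeff P k = ph k := hphr.mFourierCoeff_fourierSynth
  have hPreal : ∀ y, conj (P y) = P y := fun y => conj_fourierSynth_scalar hphs y
  set r : 𝕋³ → ℝ := fun y => (P y).re with hr
  have hrs : IsSmooth r := hPs.comp_clm (G := ℝ) Complex.reCLM
  have hrP : (fun y => ((r y : ℝ) : ℂ)) = P := by
    funext y
    exact Complex.conj_eq_iff_re.1 (hPreal y)
  refine ⟨r, hrs, fun k => ?_⟩
  rw [mFourierCoeff_gradient_real hrs k, hrP, hPc k]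
  by_cases hk : k = 0
  · subst hk
    rw [FluidPDE.Torus.lerayCoeff_zero, hF0, FluidPDE.Torus.freqVec_zero, smul_zero, sub_zero]
  · have hq : ((freqNormSq k : ℝ) : ℂ) ≠ 0 := by
      exact_mod_cast (ne_of_gt (lt_of_lt_of_le one_pos (one_le_freqNormSq' hk)))
    have hsplit := sub_lerayCoeff hk (F k)
    have hcoef : 2 * Real.pi * Complex.I * ph k = -(kdot[k, F k] / ((freqNormSq k : ℝ) : ℂ)) := by
      simp only [hph]
      have e : kdot[k, (-F k)] = -kdot[k, F k] := by
        simp only [PiLp.neg_apply, mul_neg, Finset.sum_neg_distrib]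
      rw [e]
      field_simp
    rw [hcoef, neg_smul, ← hsplit]
    abel


/-! ## §2 The synthesised test field is divergence free and mean zero -/

/-- The real synthesis `Re F_c` of a rapidly decaying, conjugate-symmetric, TRANSVERSAL family `c` with
`c 0 = 0` is divergence free and mean zero (as in `SteadyLatticeDrift.steadyState_of_fourier'`). [folklore] -/
theorem isDivFree_hasZeroMean_realSynth {c : (Fin 3 → ℤ) → EuclideanSpace ℂ (Fin 3)} (hc : RapidDecay c)
    (hcs : IsConjSymm c) (hct : ∀ k : Fin 3 → ℤ, kdot[k, c k] = 0) (hc0 : c 0 = 0) :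
    IsDivFree (fun y => realPart (fourierSynth c y)) ∧ HasZeroMean (fun y => realPart (fourierSynth c y)) := by
  obtain ⟨hu, -, hû⟩ := realSynth_spec hc hcs
  constructor
  · intro y
    set D : 𝕋³ → ℂ := fun z => ∑ l, Torus.partialDeriv l
      (fun w => (((fun y => realPart (fourierSynth c y)) w l : ℝ) : ℂ)) z with hD
    have hDc : Continuous D :=
      continuous_finsetSum _ fun l _ => (((hu.apply l).ofReal).partialDeriv l).continuous
    have hDcoeff : ∀ k, mFourierCoeff D k = 0 := by
      intro k
      rw [hD, mFourierCoeff_finset_sum (f := fun l => Torus.partialDeriv l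
        (fun w => (((fun y => realPart (fourierSynth c y)) w l : ℝ) : ℂ))) _
        (fun l _ => (((hu.apply l).ofReal).partialDeriv l).integrable)]
      have h2 : ∀ l, mFourierCoeff (Torus.partialDeriv l
          (fun w => (((fun y => realPart (fourierSynth c y)) w l : ℝ) : ℂ))) k = dsym l k * c k l :=
          fun l => by
        rw [mFourierCoeff_partialDeriv ((hu.apply l).ofReal) l k, coeff_ofReal_apply hu k l, hû, dsym_apply,
            smul_eq_mul]
      simp only [h2, dsym_apply]
      calc ∑ l, 2 * ↑Real.pi * Complex.I * (((k l : ℤ) : ℂ)) * c k l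
          = 2 * ↑Real.pi * Complex.I * kdot[k, c k] := by
            rw [Finset.mul_sum]; exact Finset.sum_congr rfl fun l _ => by ring
        _ = 0 := by rw [hct k, mul_zero]
    have hD0 : D = 0 := eq_zero_of_forall_mFourierCoeff_eq_zero hDc hDcoeff
    have hy := congrFun hD0 y
    simp only [hD, Pi.zero_apply, partialDeriv_ofReal_apply hu] at hy
    unfold Torus.divergence
    exact_mod_cast hy
  · have h0 : mFourierCoeff (complexify ∘ fun y => realPart (fourierSynth c y)) 0 = 0 := by rw [hû]; exact hc0
    rw [mFourierCoeff_complexify_zero hu] at h0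
    have h1 : (∫ x, (fun y => realPart (fourierSynth c y)) x) = 0 :=
      complexify_injective (by rw [h0, map_zero])
    exact h1

/-! ## §3 The registered stub -/

set_option maxHeartbeats 1600000 in
/-- **stub_aprioriTransfer** (the registered signature, verbatim): the crux's bordered `L²` a-priori bound at
`(u₀, c)` with constant `M` transfers to the lattice state space — for `h ∈ W` with rapidly decaying `ȟ` and
real `η`, `‖ȟ‖²_{ℓ²} + η² ≤ M² (‖(4π²ν)h − cD₃h + B(x₀,h) + B(h,x₀) − ηD₃x₀‖²_W + (ℓ h)²)`.  Proof: test the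
a-priori bound on `v := Re F_ȟ` (smooth, divergence free, mean zero), the Hodge potential `r` of the coefficients
of `Ψ := u₀·∇v + v·∇u₀ − νΔv − c∂₃v − η∂₃u₀` (so that `𝓕(Ψ + ∇r) = Π 𝓕Ψ`) and `b := η`; the dictionary identifies
`Π_k 𝓕Ψ(k)` with the coordinates of `(4π²ν)h − cD₃h + B(x₀,h) + B(h,x₀) − ηD₃x₀`, and Parseval does the rest.
[folklore; Temam1979 Ch. II §1] -/
theorem stub_aprioriTransfer :
    ∀ {W : Submodule ℝ ℓ2}
      (hW : ∀ x : ℓ2, x ∈ W ↔ cw[x] 0 = 0 ∧ (∀ kk : Fin 3 → ℤ, kdot[kk, cw[x] kk] = 0) ∧ IsConjSymm cw[x])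
      {B : W → W → W} (hB : ∀ x y : W, cw[B x y] = fun k => FluidPDE.Torus.lerayCoeff k (nl[cf[cw[x]], cf[cw[y]]] k))
      {D₃ : W →L[ℝ] W}
      (hD₃ : ∀ x : W, cw[D₃ x] = fun k => (2 * Real.pi * Complex.I * ((k (2 : Fin 3) : ℤ) : ℂ)) • cf[cw[x]] k)
      (ν c M : ℝ) (u₀ : 𝕋³ → E³) (x₀ : W) (ℓ : W →L[ℝ] ℝ),
      0 < ν → IsSmooth u₀ → IsDivFree u₀ → HasZeroMean u₀ →
      cf[cw[x₀]] = mFourierCoeff (complexify ∘ u₀) →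
      (∀ h : W, ℓ h = ∑' k : Fin 3 → ℤ, (inner ℂ (cf[cw[h]] k) (cw[D₃ x₀] k)).re) →
      (∀ (v : 𝕋³ → E³) (r : 𝕋³ → ℝ) (b : ℝ), IsSmooth v → IsSmooth r → IsDivFree v → HasZeroMean v →
        MeasureTheory.integral MeasureTheory.volume (fun x => ‖v x‖ ^ 2) + b ^ 2 ≤
          M ^ 2 * (MeasureTheory.integral MeasureTheory.volume (fun x =>
            ‖Torus.convect u₀ v x + Torus.convect v u₀ x - ν • Torus.laplacian v x + Torus.gradient r x -
              c • Torus.partialDeriv (2 : Fin 3) v x - b • Torus.partialDeriv (2 : Fin 3) u₀ x‖ ^ 2) +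
            (MeasureTheory.integral MeasureTheory.volume (fun x =>
              inner ℝ (v x) (Torus.partialDeriv (2 : Fin 3) u₀ x))) ^ 2)) →
      ∀ (h : W) (η : ℝ), RapidDecay cf[cw[h]] →
        (∑' k : Fin 3 → ℤ, ‖cf[cw[h]] k‖ ^ 2) + η ^ 2 ≤
          M ^ 2 * (‖(4 * Real.pi ^ 2 * ν) • h - c • D₃ h + B x₀ h + B h x₀ - η • D₃ x₀‖ ^ 2 + (ℓ h) ^ 2) := by
  intro W hW B hB D₃ hD₃ ν c M u₀ x₀ ℓ hν hu₀ hu₀d hu₀m hx₀ hℓ hBB h η hhr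
  -- §a lattice data of the base state and of `h`
  have har : RapidDecay (mFourierCoeff (complexify ∘ u₀)) := hu₀.complexify_comp.rapidDecay_mFourierCoeff
  have hat : ∀ m : (Fin 3 → ℤ), kdot[m, mFourierCoeff (complexify ∘ u₀) m] = 0 :=
    fun m => hu₀d.sum_mul_mFourierCoeff_eq_zero hu₀ m
  have hchs : IsConjSymm cf[cw[h]] := isConjSymm_cf (W_conj hW h)
  have hcht : ∀ k : (Fin 3 → ℤ), kdot[k, cf[cw[h]] k] = 0 := cf_transversal (W_trans hW h)
  have hch0 : cf[cw[h]] 0 = 0 := cf_zero _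
  -- §b the test field `v = Re F_ȟ`
  obtain ⟨hv, -, hvc⟩ := realSynth_spec hhr hchs
  obtain ⟨hvd, hvm⟩ := isDivFree_hasZeroMean_realSynth hhr hchs hcht hch0
  set v : 𝕋³ → E³ := fun y => realPart (fourierSynth cf[cw[h]] y) with hvdef
  -- §c the physical field `Ψ` and its coefficients
  set Ψ : 𝕋³ → E³ := fun y => Torus.convect u₀ v y + Torus.convect v u₀ y - ν • Torus.laplacian v y -
      c • Torus.partialDeriv (2 : Fin 3) v y - η • Torus.partialDeriv (2 : Fin 3) u₀ y with hΨ
  have h1 : IsSmooth (complexify ∘ Torus.convect u₀ v) := (hu₀.convect hv).complexify_comp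
  have h2 : IsSmooth (complexify ∘ Torus.convect v u₀) := (hv.convect hu₀).complexify_comp
  have h3 : IsSmooth (complexify ∘ Torus.laplacian v) := hv.laplacian.complexify_comp
  have h4 : IsSmooth (complexify ∘ Torus.partialDeriv (2 : Fin 3) v) := (hv.partialDeriv 2).complexify_comp
  have h5 : IsSmooth (complexify ∘ Torus.partialDeriv (2 : Fin 3) u₀) := (hu₀.partialDeriv 2).complexify_comp
  have hΨs : IsSmooth Ψ := by
    have h := ((((hu₀.convect hv).add (hv.convect hu₀)).sub ((hv.laplacian).smul ν)).sub
      ((hv.partialDeriv 2).smul c)).sub ((hu₀.partialDeriv 2).smul η)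
    refine (show Ψ = _ from ?_) ▸ h
    funext y
    simp only [hΨ, Pi.add_apply, Pi.sub_apply, Pi.smul_apply]
  have hfun : (complexify ∘ Ψ) = (complexify ∘ Torus.convect u₀ v) + (complexify ∘ Torus.convect v u₀) -
      (ν : ℂ) • (complexify ∘ Torus.laplacian v) - (c : ℂ) • (complexify ∘ Torus.partialDeriv (2 : Fin 3) v) -
      (η : ℂ) • (complexify ∘ Torus.partialDeriv (2 : Fin 3) u₀) := by
    funext y
    simp only [hΨ, Function.comp_apply, Pi.add_apply, Pi.sub_apply, Pi.smul_apply, map_add, map_sub,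
      LinearIsometry.map_smul, Complex.coe_smul]
  have hF : ∀ k : Fin 3 → ℤ, mFourierCoeff (complexify ∘ Ψ) k =
      nl[mFourierCoeff (complexify ∘ u₀), cf[cw[h]]] k + nl[cf[cw[h]], mFourierCoeff (complexify ∘ u₀)] k +
        (((ν * (4 * Real.pi ^ 2 * freqNormSq k)) : ℝ) : ℂ) • cf[cw[h]] k -
        (c : ℂ) • ((2 * Real.pi * Complex.I * ((k (2 : Fin 3) : ℤ) : ℂ)) • cf[cw[h]] k) -
        (η : ℂ) • ((2 * Real.pi * Complex.I * ((k (2 : Fin 3) : ℤ) : ℂ)) • mFourierCoeff (complexify ∘ u₀) k) := by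
    intro k
    have i1 := h1.integrable
    have i2 := h2.integrable
    have i3 : Integrable ((ν : ℂ) • (complexify ∘ Torus.laplacian v)) volume := h3.integrable.smul (ν : ℂ)
    have i4 : Integrable ((c : ℂ) • (complexify ∘ Torus.partialDeriv (2 : Fin 3) v)) volume :=
      h4.integrable.smul (c : ℂ)
    have i5 : Integrable ((η : ℂ) • (complexify ∘ Torus.partialDeriv (2 : Fin 3) u₀)) volume :=
      h5.integrable.smul (η : ℂ)
    have e4 : (complexify ∘ Torus.partialDeriv (2 : Fin 3) v) = Torus.partialDeriv (2 : Fin 3) (complexify ∘ v) := by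
      funext y; exact (partialDeriv_complexify_comp hv 2 y).symm
    have e5 : (complexify ∘ Torus.partialDeriv (2 : Fin 3) u₀) =
        Torus.partialDeriv (2 : Fin 3) (complexify ∘ u₀) := by
      funext y; exact (partialDeriv_complexify_comp hu₀ 2 y).symm
    rw [hfun, mFourierCoeff_sub (((i1.add i2).sub i3).sub i4) i5, mFourierCoeff_sub ((i1.add i2).sub i3) i4,
      mFourierCoeff_sub (i1.add i2) i3, mFourierCoeff_add i1 i2, mFourierCoeff_const_smul, mFourierCoeff_const_smul,
      mFourierCoeff_const_smul, mFourierCoeff_convect_real hu₀ hv k, mFourierCoeff_convect_real hv hu₀ k,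
      mFourierCoeff_complexify_laplacian hv k, e4, e5, mFourierCoeff_partialDeriv hv.complexify_comp 2 k,
      mFourierCoeff_partialDeriv hu₀.complexify_comp 2 k, hvc]
    simp only [smul_neg, sub_neg_eq_add, smul_smul]
    congr 2
    push_cast
    ring
  have hFr : RapidDecay (mFourierCoeff (complexify ∘ Ψ)) := hΨs.complexify_comp.rapidDecay_mFourierCoeff
  have hFcs : IsConjSymm (mFourierCoeff (complexify ∘ Ψ)) := isConjSymm_mFourierCoeff hΨs.integrable
  have hF0 : mFourierCoeff (complexify ∘ Ψ) 0 = 0 := by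
    rw [hF 0, nl_zero_of_transversal _ _ hat (fun j p => summable_nl_rapid har hhr 0 j p),
      nl_zero_of_transversal _ _ hcht (fun j p => summable_nl_rapid hhr har 0 j p), freqNormSq_zero]
    simp
  -- §d the Hodge potential and the bordered field
  obtain ⟨r, hr, hgrad⟩ := exists_hodgePotential hFr hFcs hF0
  set g : 𝕋³ → E³ := fun y => Torus.convect u₀ v y + Torus.convect v u₀ y - ν • Torus.laplacian v y +
      Torus.gradient r y - c • Torus.partialDeriv (2 : Fin 3) v y - η • Torus.partialDeriv (2 : Fin 3) u₀ y with hg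
  have hg_eq : g = fun y => Ψ y + Torus.gradient r y := by
    funext y; simp only [hg, hΨ]; abel
  have hgs : IsSmooth g := by
    rw [hg_eq]; exact hΨs.add hr.gradient
  have hgc : ∀ k : Fin 3 → ℤ, mFourierCoeff (complexify ∘ g) k =
      FluidPDE.Torus.lerayCoeff k (mFourierCoeff (complexify ∘ Ψ) k) := by
    intro k
    have e : (complexify ∘ g) = (complexify ∘ Ψ) + (complexify ∘ Torus.gradient r) := by
      rw [hg_eq]; funext y; simp
    rw [e, mFourierCoeff_add hΨs.complexify_comp.integrable hr.gradient.complexify_comp.integrable, hgrad k]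
    abel
  -- §e the coordinates of `T := (4π²ν)h − cD₃h + B(x₀,h) + B(h,x₀) − ηD₃x₀` are `Π_k 𝓕Ψ(k)`
  have hTc : ∀ k : Fin 3 → ℤ, cw[((4 * Real.pi ^ 2 * ν) • h - c • D₃ h + B x₀ h + B h x₀ - η • D₃ x₀ : W)] k =
      FluidPDE.Torus.lerayCoeff k (mFourierCoeff (complexify ∘ Ψ) k) := by
    intro k
    rw [coeW_sub, coeW_add, coeW_add, coeW_sub, coeW_smul, coeW_smul, coeW_smul, hB, hB, hD₃, hD₃, hx₀]
    simp only [Pi.add_apply, Pi.sub_apply, Pi.smul_apply]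
    rw [hF k, lerayCoeff_sub', lerayCoeff_sub', lerayCoeff_add', lerayCoeff_add', lerayCoeff_smul',
      lerayCoeff_smul', lerayCoeff_smul', lerayCoeff_smul', lerayCoeff_smul']
    by_cases hk : k = 0
    · subst hk
      simp [W_zero hW h, mFourierCoeff_complexify_zero_of_hasZeroMean hu₀ hu₀m]
    · rw [lerayCoeff_of_kdot_eq_zero hk (hcht k), lerayCoeff_of_kdot_eq_zero hk (hat k),
        ← smul_eq_weight_smul_cf (W_zero hW h) k, ← Complex.coe_smul, ← Complex.coe_smul, ← Complex.coe_smul]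
      abel
  -- §f Parseval
  have hP1 : MeasureTheory.integral MeasureTheory.volume (fun x => ‖v x‖ ^ 2) =
      ∑' k : Fin 3 → ℤ, ‖cf[cw[h]] k‖ ^ 2 := by
    rw [integral_norm_sq_eq_tsum (hv.memLp 2), hvc]
  have hP2 : MeasureTheory.integral MeasureTheory.volume (fun x => ‖g x‖ ^ 2) =
      ‖((4 * Real.pi ^ 2 * ν) • h - c • D₃ h + B x₀ h + B h x₀ - η • D₃ x₀ : W)‖ ^ 2 := by
    rw [integral_norm_sq_eq_tsum (hgs.memLp 2), ← norm_coeW, l2_norm_sq_eq_tsum]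
    exact tsum_congr fun k => by rw [hgc k, hTc k]
  have hd3 : ∀ k : Fin 3 → ℤ, mFourierCoeff (complexify ∘ Torus.partialDeriv (2 : Fin 3) u₀) k = cw[D₃ x₀] k := by
    intro k
    have e5 : (complexify ∘ Torus.partialDeriv (2 : Fin 3) u₀) =
        Torus.partialDeriv (2 : Fin 3) (complexify ∘ u₀) := by
      funext y; exact (partialDeriv_complexify_comp hu₀ 2 y).symm
    rw [e5, mFourierCoeff_partialDeriv hu₀.complexify_comp 2 k, hD₃, hx₀]
  have hP3 : MeasureTheory.integral MeasureTheory.volume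
      (fun x => inner ℝ (v x) (Torus.partialDeriv (2 : Fin 3) u₀ x)) = ℓ h := by
    rw [hℓ h, ← (hasSum_re_inner_mFourierCoeff_complexify (hv.memLp 2) ((hu₀.partialDeriv 2).memLp 2)).tsum_eq]
    exact tsum_congr fun k => by rw [hvc, hd3 k]
  -- §g the a-priori bound at `(v, r, η)`
  have hb := hBB v r η hv hr hvd hvm
  rw [hP1, hP3] at hb
  have hP2' : MeasureTheory.integral MeasureTheory.volume (fun x =>
      ‖Torus.convect u₀ v x + Torus.convect v u₀ x - ν • Torus.laplacian v x + Torus.gradient r x -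
        c • Torus.partialDeriv (2 : Fin 3) v x - η • Torus.partialDeriv (2 : Fin 3) u₀ x‖ ^ 2) =
      ‖((4 * Real.pi ^ 2 * ν) • h - c • D₃ h + B x₀ h + B h x₀ - η • D₃ x₀ : W)‖ ^ 2 := hP2
  rw [hP2'] at hb
  exact hb

end Summit.AnomalousDissipation.AnomalousDissipation.Theorems.NewtonRealisation.AprioriTransfer

end
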